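import Summits.BirchSwinnertonDyer.BirchSwinnertonDyer.Theses.TwistFamilyManinDescent
import Summits.BirchSwinnertonDyer.BirchSwinnertonDyer.Theorems.ManinLocalTwoThreeCDivisionOddSquarefreeResidual
import HarnessLib

/-!
# Route `TwistFamilyManinDescent`: the Eisenstein / ordinary-corner / supersingular Manin residuals at `p ∈ {5, 7, 13, 163}` —
# 25138, 26325, 26289, 27552, 27559, 27071 — and the dichotomy 27661, MODULO THE PRINTED CALEGARI–DIMITROV–TANG
# UNBOUNDED-DENOMINATORS THEOREM ONLY — `--supports`

Cell `pub/bsd-wall`, seat `bsd-line-ttd-p1` (prover 1/2 on the sibling line TeichmullerTwistDescent, g31; cross-route helper for the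
route pen bsd-idea-3, announced on STATUS). THEOREMS ONLY (no definition, no named fact, no `sorry`); every theorem is
`proof.conditional` on ONE cite-only PRINTED fact, the vendored unbounded-denominators theorem
`Literature.NumberTheory.Automorphic.CalegariDimitrovTang2025_unboundedDenominators_algInt` («CDT»; Calegari–Dimitrov–Tang, J. Amer.
Math. Soc. 38 (2025), Thm. 1, Remarks 58–59); nothing is closed by name; BSD is not proved; Manin's conjecture is not proved
unconditionally; no Manin theorem is announced (director-bsd (505)/(527): «closed modulo CDT; items open»).

WHAT THIS FILE DOES. Every residual below quantifies over a globally minimal `W`, a parametrisation datum `D` at a level `N` with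
`p² ∣ N` among the binders, an odd prime `p` (`5, 7, 13, 163`), and the lattice-optimality clause `Λ_W = c·Λ_f`; so each is ONE
LINE over the cell bsd-f2-manin's `ManinLocalTwoThree.CDivisionUDC.abs_maninConstant_eq_one_of_CDT_of_odd_sq_dvd` (p755101:
`|c(D)| = 1` at a level with an odd `p² ∣ N`, modulo CDT). All the other clauses — the printed Manin facts (Mazur, Abbes–Ullmo,
Česnavičius), modularity, the cell conditions on `ord_p Δ`, REDUCIBILITY of `E[p]`, the twist's reduction type, the tame-inertia
clause — are idle. (§1) `not_dvd_maninConstant_of_CDT_of_sq_dvd` (any level, any odd `p`, no reduction hypothesis at all);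
(§2) `eisensteinAdditiveManinResidual_of_CDT` (25138), `eisensteinRaynaudRegimeManinUnit_of_CDT` (26325),
`eisensteinCornerManinResidual_of_CDT` (26289), `ordinaryCornerManinResidual_of_CDT` (27552), `ordinaryCornerTameManinResidual_of_CDT`
(27559), `supersingularUnstarredStrongManinUnit_of_CDT` (27071); (§3) `ordinaryCornerDeepEdixhovenDichotomy_of_CDT` (27661) —
vacuously, its antecedent `p ∣ c` being refuted modulo CDT. NOT derived here (not Manin-unit statements): 27660, 27662, 25939, 26929,
27296, 27072 (twist-lattice position / «strong is unstarred» / Serre–Tate depth).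

HONEST STATUS: CONDITIONAL on the printed CDT fact (the cell bsd-f2-manin's trust base; audits (505)/(527) pending); the items stay
OPEN by name. BSD is not proved by this; Manin's conjecture is not proved by this. [cite: CalegariDimitrovTang2025, Thm. 1 and Remarks 58–59]
[cite: LingOesterle1991, Thm. 6] [cite: Mazur1978, Thm. 1 (the reducible primes 5, 7, 13, 163)]
-/

set_option autoImplicit false
-- single-conjunct summit: `Summit.BirchSwinnertonDyer.BirchSwinnertonDyer.…` repeats the name by design
set_option linter.dupNamespace false

noncomputable section

open scoped Classical

open WeierstrassCurve Literature.NumberTheory.EllipticCurves Literature.NumberTheory.EllipticCurves.ModularForms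
  Summit.BirchSwinnertonDyer.BirchSwinnertonDyer.Theses.TwistFamilyManinDescent
  Summit.BirchSwinnertonDyer.BirchSwinnertonDyer.Theorems

namespace Summit.BirchSwinnertonDyer.BirchSwinnertonDyer.Theorems.TwistFamilyManinDescentOfCDT

/-! ### §1 Manin's `p`-part at any level with an odd `p² ∣ N`, modulo CDT -/

/-- **`p ∤ c(D)` for every lattice-optimal datum `D` of a globally minimal curve at a level `N` with an odd `p² ∣ N`, MODULO CDT**
— the `¬ p ∣ ·` reading of the cell bsd-f2-manin's `|c(D)| = 1`. No hypothesis on the reduction of `W` at `p`. CONDITIONAL on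
`hCDT`; Manin's conjecture and BSD are not proved by this. [cite: CalegariDimitrovTang2025, Thm. 1 and Remarks 58–59] [cite: LingOesterle1991, Thm. 6] -/
theorem not_dvd_maninConstant_of_CDT_of_sq_dvd
    (hCDT : Literature.NumberTheory.Automorphic.CalegariDimitrovTang2025_unboundedDenominators_algInt)
    {W : WeierstrassCurve ℚ} [W.IsElliptic] [W.IsGloballyMinimal] {N : ℕ} [NeZero N]
    (D : ModularParametrizationData W N) {p : ℕ} (hp : p.Prime) (hp3 : 3 ≤ p) (hsq : p ^ 2 ∣ N)
    (hlat : ∀ z ∈ D.L.lattice, ∃ w ∈ periodLattice D.f, z = D.c * w) : ¬ (p : ℤ) ∣ D.maninConstant := by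
  have h1 : |D.maninConstant| = 1 :=
    ManinLocalTwoThree.CDivisionUDC.abs_maninConstant_eq_one_of_CDT_of_odd_sq_dvd hCDT D hlat hp hp3 hsq
  intro hpc
  have hdvd : (p : ℤ) ∣ |D.maninConstant| := (dvd_abs (p : ℤ) D.maninConstant).mpr hpc
  rw [h1] at hdvd
  have hp1 : p ∣ 1 := by exact_mod_cast hdvd
  exact hp.ne_one (Nat.dvd_one.mp hp1)

/-! ### §2 The route's Manin residuals BY NAME, modulo CDT -/

/-- **The Eisenstein additive Manin residual `EisensteinAdditiveManinResidual` (stmt-BirchSwinnertonDyer-25138: reducible `E[p]`,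
`p ∈ {5, 7, 13, 163}`) ⟸ CDT** (all clauses but `p² ∣ N` and lattice-optimality idle). CONDITIONAL; the item is not closed by this;
BSD is not proved by this. [cite: CalegariDimitrovTang2025, Thm. 1 and Remarks 58–59] [cite: Mazur1978, Thm. 1] -/
theorem eisensteinAdditiveManinResidual_of_CDT
    (hCDT : Literature.NumberTheory.Automorphic.CalegariDimitrovTang2025_unboundedDenominators_algInt) :
    EisensteinAdditiveManinResidual := by
  intro _mz _au _c2 _hnf W _ _ N _ D p hp hcell hsq _hred _htw hlat
  have hp3 : 3 ≤ p := by rcases hcell with rfl | rfl | rfl | ⟨rfl, _⟩ <;> omega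
  exact not_dvd_maninConstant_of_CDT_of_sq_dvd hCDT D hp hp3 hsq hlat

/-- **`EisensteinRaynaudRegimeManinUnit` (stmt-BirchSwinnertonDyer-26325: the Raynaud-regime Eisenstein cells at `5`, `7`) ⟸ CDT.**
CONDITIONAL; the item is not closed by this; BSD is not proved by this. [cite: CalegariDimitrovTang2025, Thm. 1 and Remarks 58–59] -/
theorem eisensteinRaynaudRegimeManinUnit_of_CDT
    (hCDT : Literature.NumberTheory.Automorphic.CalegariDimitrovTang2025_unboundedDenominators_algInt) :
    EisensteinRaynaudRegimeManinUnit := by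
  intro _mz _au _c2 _hnf W _ _ N _ D p hp hcell hsq _hred _htw hlat
  have hp3 : 3 ≤ p := by rcases hcell with ⟨rfl, _⟩ | ⟨rfl, _⟩ <;> omega
  exact not_dvd_maninConstant_of_CDT_of_sq_dvd hCDT D hp hp3 hsq hlat

/-- **`EisensteinCornerManinResidual` (stmt-BirchSwinnertonDyer-26289: the Eisenstein corner at `5`, `7` off the Raynaud regime)
⟸ CDT.** CONDITIONAL; the item is not closed by this; BSD is not proved by this. [cite: CalegariDimitrovTang2025, Thm. 1 and Remarks 58–59] -/
theorem eisensteinCornerManinResidual_of_CDT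
    (hCDT : Literature.NumberTheory.Automorphic.CalegariDimitrovTang2025_unboundedDenominators_algInt) :
    EisensteinCornerManinResidual := by
  intro _mz _au _c2 _hnf W _ _ N _ D p hp h57 _hnotRay hsq _hred _htw hlat
  have hp3 : 3 ≤ p := by rcases h57 with rfl | rfl <;> omega
  exact not_dvd_maninConstant_of_CDT_of_sq_dvd hCDT D hp hp3 hsq hlat

/-- **`OrdinaryCornerManinResidual` (stmt-BirchSwinnertonDyer-27552: the ORDINARY Eisenstein corner at `5`, `7`) ⟸ CDT.**
CONDITIONAL; the item is not closed by this; BSD is not proved by this. [cite: CalegariDimitrovTang2025, Thm. 1 and Remarks 58–59] -/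
theorem ordinaryCornerManinResidual_of_CDT
    (hCDT : Literature.NumberTheory.Automorphic.CalegariDimitrovTang2025_unboundedDenominators_algInt) :
    OrdinaryCornerManinResidual := by
  intro _mz _au _c2 _hnf W _ _ N _ D p hp h57 _hnotRay _hnotSS hsq _hred _htw hlat
  have hp3 : 3 ≤ p := by rcases h57 with rfl | rfl <;> omega
  exact not_dvd_maninConstant_of_CDT_of_sq_dvd hCDT D hp hp3 hsq hlat

/-- **`OrdinaryCornerTameManinResidual` (stmt-BirchSwinnertonDyer-27559: the ordinary corner's tame-inertia residual) ⟸ CDT**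
(its tame-inertia clause idle). CONDITIONAL; the item is not closed by this; BSD is not proved by this.
[cite: CalegariDimitrovTang2025, Thm. 1 and Remarks 58–59] -/
theorem ordinaryCornerTameManinResidual_of_CDT
    (hCDT : Literature.NumberTheory.Automorphic.CalegariDimitrovTang2025_unboundedDenominators_algInt) :
    OrdinaryCornerTameManinResidual := by
  intro _mz _au _c2 _hnf W _ _ N _ D p hp h57 _hnotRay _hnotSS hsq _hred _htw hlat _htame
  have hp3 : 3 ≤ p := by rcases h57 with rfl | rfl <;> omega
  exact not_dvd_maninConstant_of_CDT_of_sq_dvd hCDT D hp hp3 hsq hlat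

/-- **`SupersingularUnstarredStrongManinUnit` (stmt-BirchSwinnertonDyer-27071: reducible, potentially supersingular unstarred cells
`(5, IV)`, `(7, III)`) ⟸ CDT.** CONDITIONAL; the item is not closed by this; BSD is not proved by this.
[cite: CalegariDimitrovTang2025, Thm. 1 and Remarks 58–59] -/
theorem supersingularUnstarredStrongManinUnit_of_CDT
    (hCDT : Literature.NumberTheory.Automorphic.CalegariDimitrovTang2025_unboundedDenominators_algInt) :
    SupersingularUnstarredStrongManinUnit := by
  intro _mz _au _c2 _hnf W _ _ N _ D p hp hcell hsq _hred _htw hlat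
  have hp3 : 3 ≤ p := by rcases hcell with ⟨rfl, _⟩ | ⟨rfl, _⟩ <;> omega
  exact not_dvd_maninConstant_of_CDT_of_sq_dvd hCDT D hp hp3 hsq hlat

/-! ### §3 The deep ordinary-corner dichotomy, vacuously, modulo CDT -/

/-- **`OrdinaryCornerDeepEdixhovenDichotomy` (stmt-BirchSwinnertonDyer-27661) ⟸ CDT, VACUOUSLY**: its antecedent «`p ∣ c(D)` for the
lattice-optimal conductor-level datum» is refuted modulo CDT (`p ∈ {5, 7}`, `p² ∣ N(W)` among the binders), so the dichotomy holds
with nothing to prove. CONDITIONAL; the item is not closed by this; BSD is not proved by this. [cite: CalegariDimitrovTang2025, Thm. 1 and Remarks 58–59] -/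
theorem ordinaryCornerDeepEdixhovenDichotomy_of_CDT
    (hCDT : Literature.NumberTheory.Automorphic.CalegariDimitrovTang2025_unboundedDenominators_algInt) :
    OrdinaryCornerDeepEdixhovenDichotomy := by
  intro W _ _ p _ _ D hsq hcell _hred _htw hlat _hdeep hpc
  have hp3 : 3 ≤ p := by rcases hcell with ⟨rfl, _⟩ | ⟨rfl, _⟩ <;> omega
  exact absurd hpc (not_dvd_maninConstant_of_CDT_of_sq_dvd hCDT D Fact.out hp3 hsq hlat)

end Summit.BirchSwinnertonDyer.BirchSwinnertonDyer.Theorems.TwistFamilyManinDescentOfCDT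

end
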